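import Mathlib
import Literature.Computability.AlgebraicComplexity.NestFreeMatchingPoly
import HarnessLib

/-!
# Route FifoMatching — crux `NNDivisionHard` (stmt-ValiantsHypothesis-21181): the PINNED RAINBOW FACE — definitions

Objects of the «stack powers do not help the queue» step of the residual programme of stmt-21181 (module docstrings of
`…NNDivisionHardFaceReading` / `…NNDivisionHardStackPowers`: identify ONE rainbow-pinned face of the nest-free matching
polytope `NFP_n` as `x^{pins} · NN_a[0, 2a)`).  For a block size `a` with `4a+2 ≤ 2n`, `n ≤ 3a+1` (e.g. `a = ⌊(n+2)/3⌋`):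

* `pinNat n a` — the PIN MATCHING of the block `[2a, 2n)` (local coordinate `q = p − 2a`, `v = 2n − 4a − 1`): the RAINBOW
  arc `(2a, 2n−1−2a)`, the pairwise-crossing arcs `(2a+t, 2a+t+v)`, `1 ≤ t ≤ v−1` (all crossing the rainbow arc), and the
  short arcs `(2a+2v+2s, 2a+2v+2s+1)` to their right — a nest-free perfect matching of the block containing a rainbow arc;
  `pinFin` — the same as a self-map of `Fin (2n)`; `pinOpeners`, `pinExp` — its openers and its arc-indicator exponent
  `χ_{pins}`;
* `glue n a N` — the perfect matching of `[0, 2n)` that is `N` on the left block `[0, 2a)` and the pins on `[2a, 2n)`;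
  `restrictM` — restriction of a matching of `[0, 2n)` to the left block; `shiftMatching a` — the witness `i ↦ i ± a`
  (a nest-free perfect matching of `[0, 2a)`); `blockEmb` — the embedding of arc variables `[0,2a)² ↪ [0,2n)²`;
* `pinWeight = 𝟙_{pins}`, `prWeight = (n+1)·𝟙_R + 𝟙_{pins}` — the PINNED RAINBOW DIRECTION (`R` = the rainbow arcs
  `(i, 2n−1−i)`), of the shape `B·𝟙_R + w₁` required by `StackPowers.generic_noncrossingPow`; `rainbowCount`,
  `pinCount` — the two arc counts entering the weight of a matching in that direction.

Values of `pinFin`, `glue`, `restrictM` are clamped by `%` so that the definitions carry no hypotheses; the lemmas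
(`…NNDivisionHardPinBlock`, `…NNDivisionHardPinnedRainbowFace`, `…NNDivisionHardStackPowersQueue`) carry `4a+2 ≤ 2n`,
`n ≤ 3a+1`.  HONEST FRAMING: definitions only; nothing here bears on the crux, on `NNNotVP` or on VP ≠ VNP.
References: Chen–Deng–Du–Stanley–Yan 2007 §1 [ChenDengDuStanleyYan2007]; Jukna–Seiwert–Sergeev 2022 [JuknaSeiwertSergeev2022].
-/

noncomputable section

-- Sub = Summit single-conjunct layout: the duplicated namespace component is mandated by the tree.
set_option linter.dupNamespace false
set_option autoImplicit false

namespace Summit.ValiantsHypothesis.ValiantsHypothesis.Theorems.FifoMatching.NNDivisionHard.StackPowersQueue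

open Finset Literature.Computability.AlgebraicComplexity

variable {n a : ℕ}

/-- The PIN partner function on `ℕ` (block `[2a, 2n)`, local coordinate `q = p − 2a`, `v = 2n − 4a − 1`): the RAINBOW arc
`(2a, 2n−2a−1)`, the pairwise-crossing arcs `(2a+t, 2a+t+v)` (`1 ≤ t ≤ v−1`, all crossing the rainbow arc), and the short
arcs `(2a+2v+2s, 2a+2v+2s+1)` to their right.  Meaningful for `4a+2 ≤ 2n`, `n ≤ 3a+1`, `2a ≤ p < 2n`. [folklore] -/
def pinNat (n a p : ℕ) : ℕ :=
  if p - 2 * a = 0 then 2 * n - 2 * a - 1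
  else if p - 2 * a < 2 * n - 4 * a - 1 then p + (2 * n - 4 * a - 1)
  else if p - 2 * a = 2 * n - 4 * a - 1 then 2 * a
  else if p - 2 * a < 2 * (2 * n - 4 * a - 1) then p - (2 * n - 4 * a - 1)
  else if (p - 2 * a - 2 * (2 * n - 4 * a - 1)) % 2 = 0 then p + 1 else p - 1

/-- The pins as a self-map of `Fin (2n)` (value clamped by `% (2n)`; equal to `pinNat` in the meaningful range,
`val_pinFin`). [folklore] -/
def pinFin (n a : ℕ) (p : Fin (2 * n)) : Fin (2 * n) :=
  ⟨pinNat n a p % (2 * n), Nat.mod_lt _ (Nat.zero_lt_of_lt p.isLt)⟩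

/-- GLUING: a self-map `N` of `Fin (2a)` on the left block `[0, 2a)`, the pins on `[2a, 2n)` (values clamped by
`% (2n)`; see `val_glue_of_lt`, `val_glue_of_le`). [folklore] -/
def glue (n a : ℕ) (N : Fin (2 * a) → Fin (2 * a)) (i : Fin (2 * n)) : Fin (2 * n) :=
  ⟨(if h : (i : ℕ) < 2 * a then ((N ⟨i, h⟩ : Fin (2 * a)) : ℕ) else pinNat n a i) % (2 * n),
    Nat.mod_lt _ (Nat.zero_lt_of_lt i.isLt)⟩

/-- Restriction of a self-map of `Fin (2n)` to the left block `[0, 2a)` (values clamped by `% (2a)`). [folklore] -/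
def restrictM (hle : 2 * a ≤ 2 * n) (M : Fin (2 * n) → Fin (2 * n)) (j : Fin (2 * a)) : Fin (2 * a) :=
  ⟨(M (Fin.castLE hle j) : ℕ) % (2 * a), Nat.mod_lt _ (Nat.zero_lt_of_lt j.isLt)⟩

/-- A nest-free perfect matching of `[0, 2a)` — the witness `i ↦ i ± a` (all arcs pairwise crossing) — so that the
maximal weight is attained. [folklore] -/
def shiftMatching (a : ℕ) (i : Fin (2 * a)) : Fin (2 * a) :=
  ⟨if (i : ℕ) < a then (i : ℕ) + a else (i : ℕ) - a, by have := i.isLt; split_ifs <;> omega⟩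

/-- The BLOCK EMBEDDING of arc variables `(i, j) ↦ (i, j)` from `[0, 2a)²` into `[0, 2n)²`. [folklore] -/
def blockEmb (hle : 2 * a ≤ 2 * n) : Fin (2 * a) × Fin (2 * a) → Fin (2 * n) × Fin (2 * n) :=
  Prod.map (Fin.castLE hle) (Fin.castLE hle)

/-- The PIN OPENERS: points `p ≥ 2a` with `p < pin p`. [folklore] -/
def pinOpeners (n a : ℕ) : Finset (Fin (2 * n)) :=
  univ.filter fun p => 2 * a ≤ (p : ℕ) ∧ (p : ℕ) < pinNat n a p

/-- The PIN EXPONENT `χ_{pins} = Σ_{p pin opener} δ_(p, pin p)`. [folklore] -/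
def pinExp (n a : ℕ) : (Fin (2 * n) × Fin (2 * n)) →₀ ℕ :=
  ∑ p ∈ pinOpeners n a, Finsupp.single (p, pinFin n a p) 1

/-- The PIN indicator `𝟙_{pins}` on the arcs `(i, j)` of `[0, 2n)`. [folklore] -/
def pinWeight (n a : ℕ) (e : Fin (2 * n) × Fin (2 * n)) : ℕ :=
  if 2 * a ≤ (e.1 : ℕ) ∧ (e.1 : ℕ) < (e.2 : ℕ) ∧ pinNat n a e.1 = (e.2 : ℕ) then 1 else 0

/-- The PINNED RAINBOW DIRECTION `w = (n+1)·𝟙_R + 𝟙_{pins}` (`R` = the rainbow arcs `(i, 2n−1−i)`). [folklore] -/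
def prWeight (n a : ℕ) (e : Fin (2 * n) × Fin (2 * n)) : ℕ :=
  (n + 1) * (if e.2 = Fin.rev e.1 then 1 else 0) + pinWeight n a e

/-- Number of RAINBOW arcs of `M`. [folklore] -/
def rainbowCount (M : Fin (2 * n) → Fin (2 * n)) : ℕ :=
  ((openers M).filter fun i => M i = Fin.rev i).card

/-- Number of PIN arcs of `M`. [folklore] -/
def pinCount (n a : ℕ) (M : Fin (2 * n) → Fin (2 * n)) : ℕ :=
  ((openers M).filter fun i : Fin (2 * n) =>
    2 * a ≤ (i : ℕ) ∧ (i : ℕ) < (M i : ℕ) ∧ pinNat n a i = (M i : ℕ)).card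

end Summit.ValiantsHypothesis.ValiantsHypothesis.Theorems.FifoMatching.NNDivisionHard.StackPowersQueue

end
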